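import Summits.BirchSwinnertonDyer.BirchSwinnertonDyer.Theorems.ClassRecordThreeEulerHalvesAtThreeWalkTildeSign
import Summits.BirchSwinnertonDyer.BirchSwinnertonDyer.Theorems.ErratumRoadFiveNonSurjCornerKolyJWalkOrders
import HarnessLib

/-!
# S7♯ of the Jetchev walk on the IRREDUCIBLE corner: the sign of `κ̃` (Gross Prop. 5.4 (1) at the deeper level) and
# the walk inputs `hκt` ∕ `h49` from PURE Selmer membership — (irr) twins of tam3-p1's `…WalkTildeSign`
# (cell `bsd-stepL`, seat `bsd-stepL-corner-p1` g11; `--supports stmt-BirchSwinnertonDyer-19947`)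

WHY. tam3's `conjAct_kolyvaginClass_root_eq_sign_smul_zhang`, `hκt_of_selmerMembership`, `h49_of_selmerMembership`
(helper toward 19109, `ρ̄_{E,p}` ONTO) use surjectivity in exactly one way: admissibility of `E(K[m]) ⊆ E(K̄)` for `p^j`
(`E(K[m])[p] = 0`, x11b3 `RingClassNoTorsion.isAdmissible_pointsSubgroup`). On the corner (`E[p]` irreducible, `ρ̄` not
onto) admissibility is x11b3's `NoTorsionIrr.isAdmissible_pointsSubgroup_of_hasIrreducibleModPGaloisRep` (PROVED Weil
pairing `W.exists_weilPairing_holds`, `p` unramified in `K` from `SatisfiesHeegnerHypothesis p K`, `p ∤ m` because every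
prime factor of an admissible conductor is a Kolyvagin prime `≠ p`). THIS FILE: the three theorems re-keyed
(`…_of_irreducible`), proofs = tam3's with that one substitution; `hκt_of_selmerMembership_of_irreducible` moreover asks
the finiteness `hdivfin` (`ord_p P_s < ∞` when `M(s) = ∞`, i.e. at `s = 1`) and delivers its conclusion only at the
multiples `s` of the base conductor `c` — the shape the based walk consumes (`tamagawaExponent_le_m_of_orderedFamiliesBase`,
binder `hκt : ∀ s, c ∣ s.1 → …`) — because on a corner frame (no `L(E^{d_K}, 1) ≠ 0` binder) the bottom point `y_K` is
not known to be non-torsion unless `c = 1`. Uses this seat's g7 twin `exists_tildeClass_of_exactDepth_of_irreducible`.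
HONEST FRAMING: three theorems, no definition ∕ fact ∕ sorry; Gross Prop. 5.3 (`h53`) and the pure Selmer membership
(`hselmer` ∕ `hsel0`) stay hypotheses exactly as in tam3's file; no stub closes; nothing about any curve; T7.
References (locators only): [cite: Jetchev2008, §3.1 items 6–7 (p. 817), Prop. 4.5–4.6, Prop. 4.9 (pp. 819–821)]
[cite: GrossLMS1991, §5 Prop. 5.3, Prop. 5.4 (1)–(2)] [cite: McCallumLMS1991, §4 (4)–(6)].
-/

set_option autoImplicit false

noncomputable section

open scoped Classical NumberField

namespace Summit.BirchSwinnertonDyer.Rank1Residual.X11b.Three.Koly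

open WeierstrassCurve IsDedekindDomain NumberField Field Literature.NumberTheory.EllipticCurves
  Literature.NumberTheory.EllipticCurves.ModularForms Literature.NumberTheory.EllipticCurves.KolyvaginCocycle
  Literature.NumberTheory.EllipticCurves.Jetchev2008 Literature.NumberTheory.GaloisRepresentations
  Summit.BirchSwinnertonDyer.Rank1Residual.X11b Summit.BirchSwinnertonDyer.Rank1Residual.JET

variable {K : Type} [Field K] [NumberField K] {N : ℕ} [NeZero N] {W : WeierstrassCurve ℚ}
  {Dt : ModularParametrizationData W N} {β : ℤ} {ι : K →+* ℂ} {n : ℕ}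

/-- **The sign of `κ̃` for the concrete data, `E[p]` IRREDUCIBLE** (tam3's
`conjAct_kolyvaginClass_root_eq_sign_smul_zhang` with admissibility from x11b3 `NoTorsionIrr`, `p` unramified in `K`): with the congruence of Gross Prop. 5.4 (1) at
level `p^{k+u}` from bsd-jet's `JET.pointsMap_derivedPoint_concrete_of_prop53_zhang` (data at the
divisors of `n`, all prime factors Kolyvagin of index `≥ k + u`, `(N, d_K) = 1`, `d_K < −4`, modulo
Gross Prop. 5.3 `h53` at every divisor) and the `τ̃`-stability of `E(K[n])`
(`RingClassConj.pointsMap_mem_pointsSubgroup`): `c_* c(Q) = (ε·(−1)^{#primes of n}) • c(Q)` for every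
`p^u`-th root `Q` of `P_n` with `[Q]` invariant mod `p^k`. [cite: GrossLMS1991, Prop. 5.3, Prop. 5.4]
[cite: Jetchev2008, §3.1 items 6–7 (p. 817)] -/
theorem conjAct_kolyvaginClass_root_eq_sign_smul_zhang_of_irreducible [W.IsElliptic] [W.IsGloballyMinimal]
    (hK : IsImaginaryQuadratic K) {p : ℕ} (hp : p.Prime) (hp2 : p ≠ 2)
    (hirr : W.HasIrreducibleModPGaloisRep p) (hHp : SatisfiesHeegnerHypothesis p K)
    (hND : IsCoprime (N : ℤ) (NumberField.discr K)) (hD : NumberField.discr K < -4)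
    {k u : ℕ} (hk : 1 ≤ k) (hn : Squarefree n)
    (hkol : ∀ q ∈ n.primeFactors,
      Zhang2014.IsKolyvaginPrime N W K p q ∧ k + u ≤ Zhang2014.kolyvaginIndex W p q)
    (data : (m : ℕ) → m ∣ n → KolyvaginHeegnerData Dt β ι m)
    {c : K ≃ₐ[ℚ] K} (hc : c ≠ 1) (ε : ℤ)
    (h53 : ∀ (m : ℕ) (hm : m ∣ n) (τm : ringClassField K ι m ≃ₐ[ℚ] ringClassField K ι m),
      (∀ x : ringClassField K ι m, ((τm x : ringClassField K ι m) : ℂ) = starRingEnd ℂ x) →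
      ∃ σ' ∈ ringClassGal ι m, IsOfFinAddOrder
        (pointGalHom W (ringClassField K ι m) τm (data m hm).y -
          ε • pointGalHom W (ringClassField K ι m) σ' (data m hm).y))
    (Q : (W.baseChange (ringClassField K ι n)).toAffine.Point)
    (hQP : ((p ^ u : ℕ) : ℤ) • Q = (data n dvd_rfl).derivedPoint)
    (hAk : IsAdmissible (absoluteGaloisGroup K) (data n dvd_rfl).pointsSubgroup ((p ^ k : ℕ) : ℤ))
    (hQ : (data n dvd_rfl).toGeomPoints Q ∈
      invPoints (absoluteGaloisGroup K) (data n dvd_rfl).pointsSubgroup ((p ^ k : ℕ) : ℤ)) :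
    conjAct W c ((p ^ k : ℕ) : ℤ) (kolyvaginClass (W.baseChange K) ((p ^ k : ℕ) : ℤ)
        ((W.baseChange K).zsmul_geomPoints_surjective_of_charZero
          (by exact_mod_cast pow_ne_zero k hp.ne_zero)) hAk ((data n dvd_rfl).toGeomPoints Q) hQ) =
      (ε * (-1) ^ n.primeFactors.card) • kolyvaginClass (W.baseChange K) ((p ^ k : ℕ) : ℤ)
        ((W.baseChange K).zsmul_geomPoints_surjective_of_charZero
          (by exact_mod_cast pow_ne_zero k hp.ne_zero)) hAk ((data n dvd_rfl).toGeomPoints Q) hQ := by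
  have hτ : IsLiftOfAut c (liftAut c) := isLiftOfAut_liftAut c
  have hKunr : ∀ v : HeightOneSpectrum (𝓞 ℚ), (p : 𝓞 ℚ) ∈ v.asIdeal →
      Algebra.IsUnramifiedIn (𝓞 K) v.asIdeal :=
    isUnramifiedIn_of_satisfiesHeegnerHypothesis_of_dvd hK hHp hp (dvd_refl p)
  have hpn : ¬ p ∣ n := fun h ↦
    (hkol p (Nat.mem_primeFactors.mpr ⟨hp, h, hn.ne_zero⟩)).1.2.2.2.1 rfl
  have hA : ∀ (m : ℕ) (hm : m ∣ n),
      IsAdmissible (absoluteGaloisGroup K) (data m hm).pointsSubgroup ((p ^ (k + u) : ℕ) : ℤ) :=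
    fun m hm ↦ NoTorsionIrr.isAdmissible_pointsSubgroup_of_hasIrreducibleModPGaloisRep _ hK
      (ne_zero_of_dvd_ne_zero hn.ne_zero hm) hp hp2 hirr (W.exists_weilPairing_holds p) hKunr
      (fun h ↦ hpn (h.trans hm)) (k + u)
  obtain ⟨B, hB, hcong⟩ := pointsMap_derivedPoint_concrete_of_prop53_zhang hK ι hp
    (le_trans hk (Nat.le_add_right k u)) Dt hND hD hn hkol data hc hτ ε h53 hA n dvd_rfl
  exact conjAct_kolyvaginClass_root_eq_smul (data n dvd_rfl) hp (hA n dvd_rfl) hτ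
    (RingClassConj.pointsMap_mem_pointsSubgroup hK hn.ne_zero (data n dvd_rfl) hτ) _ ⟨B, hB, hcong⟩ Q
    hQP hAk hQ

/-- **The walk's `hκt` from PURE Selmer membership, `E[p]` IRREDUCIBLE, based at `c`** (tam3's
`hκt_of_selmerMembership`; the finiteness `hdivfin` and the conclusion are asked only at multiples of `c`). For data `D` on the admissible-conductor subtype
(level `k ≥ 1`), the hypothesis `hκt` of `Koly.tamagawaExponent_le_m_of_admissibleFamilies` (p497855)
follows from: the frame (`K` imaginary quadratic, `(N_E, d_K) = 1`, `d_K < −4`, `p` odd, `ρ̄_{E,p}`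
onto, `c ≠ 1` in `Aut(K/ℚ)`), Gross Prop. 5.3 at every admissible conductor for a sign `ε` (`h53`,
printed, cite-only), the sign convention `hebε` (`eb m` iff `ε·(−1)^{#primes of m} = 1`), the finiteness `hdivfin` of `ord_p(P_s)` when `M(s) = ∞`, and the PURE Selmer membership
`hselmer`: the class of every `p^u`-th root `Q` of `P_s` (`p^{u+1} ∤ P_s`, `u + k ≤ M(s)`, `[Q]` invariant
mod `p^k`) lies in `H_{𝓕(s)} = (selmerF W p^k 𝒯 (placesDividing K s)).selmerGroup` — [J] Prop. 4.5–4.6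
and the transverse condition, the one input of S7♯ left. [cite: Jetchev2008, §3.1 item 7, Prop. 4.5–4.6
(pp. 817–820)] [cite: GrossLMS1991, Prop. 5.3, Prop. 5.4] -/
theorem hκt_of_selmerMembership_of_irreducible (W : WeierstrassCurve ℚ) [W.IsElliptic] [W.IsGloballyMinimal]
    [NeZero (W.conductorNorm ℤ)] (hK : IsImaginaryQuadratic K)
    (hND : IsCoprime ((W.conductorNorm ℤ : ℕ) : ℤ) (NumberField.discr K)) (hD : NumberField.discr K < -4)
    {p : ℕ} [Fact p.Prime] (hp2 : p ≠ 2) (hirr : W.HasIrreducibleModPGaloisRep p)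
    (hHp : SatisfiesHeegnerHypothesis p K)
    (Dt : ModularParametrizationData W (W.conductorNorm ℤ)) (β : ℤ) (ι : K →+* ℂ) {τ : K ≃ₐ[ℚ] K}
    (hτ : τ ≠ 1) {k : ℕ} (hk : 1 ≤ k)
    (𝒯 : Literature.NumberTheory.GaloisRepresentations.DiscreteGaloisModule.SelmerStructure
      ((W.baseChange K).torsionGaloisModule ((p ^ k : ℕ) : ℤ)))
    (D : ∀ s : {m : ℕ // Squarefree m ∧ ∀ q ∈ m.primeFactors,
        Zhang2014.IsKolyvaginPrime (W.conductorNorm ℤ) W K p q ∧ k ≤ Zhang2014.kolyvaginIndex W p q},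
      KolyvaginHeegnerData Dt β ι s.1)
    (eb : ℕ → Bool) (ε : ℤ)
    (hebε : ∀ m, (if eb m then (1 : ℤ) else -1) = ε * (-1) ^ m.primeFactors.card)
    (h53 : ∀ (s s' : {m : ℕ // Squarefree m ∧ ∀ q ∈ m.primeFactors,
        Zhang2014.IsKolyvaginPrime (W.conductorNorm ℤ) W K p q ∧ k ≤ Zhang2014.kolyvaginIndex W p q})
      (hss' : s'.1 ∣ s.1) (τm : ringClassField K ι s'.1 ≃ₐ[ℚ] ringClassField K ι s'.1),
      (∀ x : ringClassField K ι s'.1, ((τm x : ringClassField K ι s'.1) : ℂ) = starRingEnd ℂ x) →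
      ∃ σ' ∈ ringClassGal ι s'.1, IsOfFinAddOrder
        (pointGalHom W (ringClassField K ι s'.1) τm (D s').y -
          ε • pointGalHom W (ringClassField K ι s'.1) σ' (D s').y))
    (c : ℕ) (hdivfin : ∀ s, c ∣ s.1 → Zhang2014.levelIndex W p s.1 = ⊤ → divOrd (D s) p ≠ ⊤)
    (hselmer : ∀ s (u : ℕ) (Q : (W.baseChange (ringClassField K ι s.1)).toAffine.Point)
      (hAk : IsAdmissible (absoluteGaloisGroup K) (D s).pointsSubgroup ((p ^ k : ℕ) : ℤ))
      (hQ : (D s).toGeomPoints Q ∈ invPoints (absoluteGaloisGroup K) (D s).pointsSubgroup ((p ^ k : ℕ) : ℤ)),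
      ((p ^ u : ℕ) : ℤ) • Q = (D s).derivedPoint →
      (¬ ∃ Q' : (W.baseChange (ringClassField K ι s.1)).toAffine.Point,
        ((p ^ (u + 1) : ℕ) : ℤ) • Q' = (D s).derivedPoint) →
      ((u + k : ℕ) : ℕ∞) ≤ Zhang2014.levelIndex W p s.1 →
      (kolyvaginClass (W.baseChange K) ((p ^ k : ℕ) : ℤ)
        ((W.baseChange K).zsmul_geomPoints_surjective_of_charZero
          (by exact_mod_cast pow_ne_zero k (Fact.out : p.Prime).ne_zero)) hAk ((D s).toGeomPoints Q) hQ :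
          galoisCohomology ((W.baseChange K).torsionGaloisModule ((p ^ k : ℕ) : ℤ)) 1) ∈
        (selmerF W ((p ^ k : ℕ) : ℤ) 𝒯 (placesDividing K s.1)).selmerGroup) :
    ∀ s, c ∣ s.1 →
      (if divOrd (D s) p < Zhang2014.levelIndex W p s.1 then divOrd (D s) p else (⊤ : ℕ∞)) +
        (k : ℕ∞) ≤ Zhang2014.levelIndex W p s.1 →
      ∃ x : galoisCohomology ((W.baseChange K).torsionGaloisModule ((p ^ k : ℕ) : ℤ)) 1,
        x ∈ signPart W K τ ((p ^ k : ℕ) : ℤ) (if eb s.1 then 1 else -1)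
          (selmerF W ((p ^ k : ℕ) : ℤ) 𝒯 (placesDividing K s.1)).selmerGroup ∧
        addOrderOf x = p ^ k ∧
        ((D s).kolyvaginClass (Fact.out : p.Prime) k :
            galoisCohomology ((W.baseChange K).torsionGaloisModule ((p ^ k : ℕ) : ℤ)) 1) =
          p ^ (if divOrd (D s) p < Zhang2014.levelIndex W p s.1 then divOrd (D s) p
            else (⊤ : ℕ∞)).toNat • x := by
  have hp : p.Prime := Fact.out
  intro s hcs hs
  by_cases hlt : divOrd (D s) p < Zhang2014.levelIndex W p s.1
  · rw [if_pos hlt] at hs ⊢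
    have hne : divOrd (D s) p ≠ ⊤ := ne_top_of_lt hlt
    obtain ⟨u, hu⟩ : ∃ u : ℕ, divOrd (D s) p = u := ⟨_, (ENat.coe_toNat hne).symm⟩
    rw [hu] at hs hlt ⊢
    simp only [ENat.toNat_coe]
    have hdvd : PDiv (D s) p u := pDiv_of_le_divOrd _ _ _ (le_of_eq hu.symm)
    have hndvd : ¬ PDiv (D s) p (u + 1) := fun h ↦ by
      have h' := le_divOrd_of_pDiv (p := p) (D s) h
      rw [hu] at h'
      exact absurd (by exact_mod_cast h' : u + 1 ≤ u) (by omega)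
    have huk : ((u + k : ℕ) : ℕ∞) ≤ Zhang2014.levelIndex W p s.1 := by push_cast; exact hs
    have hkol : ∀ q ∈ s.1.primeFactors,
        Zhang2014.IsKolyvaginPrime (W.conductorNorm ℤ) W K p q ∧ k + u ≤ Zhang2014.kolyvaginIndex W p q :=
      fun q hq ↦ ⟨(s.2.2 q hq).1, by
        rw [Nat.add_comm]; exact Zhang2014.natCast_le_levelIndex_iff.mp huk q hq⟩
    have hdiv : ∀ m : ℕ, m ∣ s.1 → Squarefree m ∧ ∀ q ∈ m.primeFactors,
        Zhang2014.IsKolyvaginPrime (W.conductorNorm ℤ) W K p q ∧ k ≤ Zhang2014.kolyvaginIndex W p q :=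
      fun m hm ↦ ⟨s.2.1.squarefree_of_dvd hm, fun q hq ↦
        s.2.2 q (Nat.primeFactors_mono hm s.2.1.ne_zero hq)⟩
    obtain ⟨hAk, Q, hQ, hQP, hord, hκ⟩ := exists_tildeClass_of_exactDepth_of_irreducible (Dt := Dt) (β := β)
      hK hND hD hp hp2 hirr hHp hk s.2.1 hkol (fun m hm ↦ D ⟨m, hdiv m hm⟩) hdvd hndvd
    -- the sign, from Gross Prop. 5.4 (1) at level `p^{k+u}`
    have key := conjAct_kolyvaginClass_root_eq_sign_smul_zhang_of_irreducible (Dt := Dt) (β := β) hK hp hp2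
      hirr hHp hND hD hk s.2.1 hkol (fun m hm ↦ D ⟨m, hdiv m hm⟩) hτ ε
      (fun m hm τm hτm ↦ h53 s ⟨m, hdiv m hm⟩ hm τm hτm) Q hQP hAk hQ
    refine ⟨_, (mem_signPart_iff W K τ _ _ _ _).mpr ⟨hselmer s u Q hAk hQ hQP hndvd huk, by
      rw [hebε]; exact key⟩, hord, ?_⟩
    rw [← natCast_zsmul]
    exact hκ
  · rw [if_neg hlt, top_add, top_le_iff] at hs
    exact (hlt (lt_of_lt_of_eq (lt_top_iff_ne_top.mpr (hdivfin s hcs hs)) hs.symm)).elim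

/-- **The walk's `h49` from PURE Selmer membership, `E[p]` IRREDUCIBLE** — tam3's `h49_of_selmerMembership`; (the sign half of [J] Prop. 4.9 discharged). For
data `D` on the admissible-conductor subtype (level `k ≥ 1`), signs `eb`/`ε` with `hebε`, and Gross
Prop. 5.3 at every admissible conductor (`h53`, print, cite-only): the hypothesis `h49` of
`Koly.tamagawaExponent_le_m_of_orderedFamiliesBase` — `c_k(sℓ) ∈ (H_{𝓕₀(s)^λ})^{−ε(s)}` — follows from
the PURE membership `hsel0 : c_k(sℓ) ∈ H_{𝓕₀(s)^λ}` ([J] Prop. 4.5–4.6 ∕ 4.9: the local conditions of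
`c_k(sℓ)` away from `λ`), the sign being Gross Prop. 5.4 (1) for `P_{sℓ}` itself (`u = 0` in
`conjAct_kolyvaginClass_root_eq_sign_smul_zhang`): `τ_* c_k(sℓ) = ε(−1)^{#primes(sℓ)} c_k(sℓ) = −ε(s) c_k(sℓ)`.
The premises of `h49` (`ℓ` prime, `ℓ ∤ s`, `s' = sℓ`, `ℓ` above `s`, `c ∣ s`) are passed through.
[cite: Jetchev2008, §3.1 item 6, Prop. 4.9 (pp. 817–821)] [cite: GrossLMS1991, Prop. 5.3, Prop. 5.4] -/
theorem h49_of_selmerMembership_of_irreducible (W : WeierstrassCurve ℚ) [W.IsElliptic] [W.IsGloballyMinimal]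
    [NeZero (W.conductorNorm ℤ)] (hK : IsImaginaryQuadratic K)
    (hND : IsCoprime ((W.conductorNorm ℤ : ℕ) : ℤ) (NumberField.discr K)) (hD : NumberField.discr K < -4)
    {p : ℕ} [Fact p.Prime] (hp2 : p ≠ 2) (hirr : W.HasIrreducibleModPGaloisRep p)
    (hHp : SatisfiesHeegnerHypothesis p K)
    (Dt : ModularParametrizationData W (W.conductorNorm ℤ)) (β : ℤ) (ι : K →+* ℂ) {τ : K ≃ₐ[ℚ] K}
    (hτ : τ ≠ 1) {k : ℕ} (hk : 1 ≤ k)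
    (𝒯 𝒮 : Literature.NumberTheory.GaloisRepresentations.DiscreteGaloisModule.SelmerStructure
      ((W.baseChange K).torsionGaloisModule ((p ^ k : ℕ) : ℤ)))
    (Qcar : Finset (HeightOneSpectrum (𝓞 K)))
    (D : ∀ s : {m : ℕ // Squarefree m ∧ ∀ q ∈ m.primeFactors,
        Zhang2014.IsKolyvaginPrime (W.conductorNorm ℤ) W K p q ∧ k ≤ Zhang2014.kolyvaginIndex W p q},
      KolyvaginHeegnerData Dt β ι s.1)
    (eb : ℕ → Bool) (ε : ℤ)
    (hebε : ∀ m, (if eb m then (1 : ℤ) else -1) = ε * (-1) ^ m.primeFactors.card)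
    (h53 : ∀ (s s' : {m : ℕ // Squarefree m ∧ ∀ q ∈ m.primeFactors,
        Zhang2014.IsKolyvaginPrime (W.conductorNorm ℤ) W K p q ∧ k ≤ Zhang2014.kolyvaginIndex W p q})
      (hss' : s'.1 ∣ s.1) (τm : ringClassField K ι s'.1 ≃ₐ[ℚ] ringClassField K ι s'.1),
      (∀ x : ringClassField K ι s'.1, ((τm x : ringClassField K ι s'.1) : ℂ) = starRingEnd ℂ x) →
      ∃ σ' ∈ ringClassGal ι s'.1, IsOfFinAddOrder
        (pointGalHom W (ringClassField K ι s'.1) τm (D s').y -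
          ε • pointGalHom W (ringClassField K ι s'.1) σ' (D s').y))
    (c : ℕ)
    (hsel0 : ∀ (s s' : {m : ℕ // Squarefree m ∧ ∀ q ∈ m.primeFactors,
        Zhang2014.IsKolyvaginPrime (W.conductorNorm ℤ) W K p q ∧ k ≤ Zhang2014.kolyvaginIndex W p q})
      (ℓ : ℕ), ℓ.Prime → ¬ ℓ ∣ s.1 → s'.1 = s.1 * ℓ → (∀ q ∈ s.1.primeFactors, q < ℓ) → c ∣ s.1 →
      ∀ v : HeightOneSpectrum (𝓞 K), (ℓ : 𝓞 K) ∈ v.asIdeal →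
      ((D s').kolyvaginClass (Fact.out : p.Prime) k :
          galoisCohomology ((W.baseChange K).torsionGaloisModule ((p ^ k : ℕ) : ℤ)) 1) ∈
        (((selmerF0 W ((p ^ k : ℕ) : ℤ) 𝒯 𝒮 (placesDividing K s.1) Qcar).relaxedAt {v}).selmerGroup)) :
    ∀ (s s' : {m : ℕ // Squarefree m ∧ ∀ q ∈ m.primeFactors,
        Zhang2014.IsKolyvaginPrime (W.conductorNorm ℤ) W K p q ∧ k ≤ Zhang2014.kolyvaginIndex W p q})
      (ℓ : ℕ), ℓ.Prime → ¬ ℓ ∣ s.1 → s'.1 = s.1 * ℓ → (∀ q ∈ s.1.primeFactors, q < ℓ) → c ∣ s.1 →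
      ∀ v : HeightOneSpectrum (𝓞 K), (ℓ : 𝓞 K) ∈ v.asIdeal →
      ((D s').kolyvaginClass (Fact.out : p.Prime) k :
          galoisCohomology ((W.baseChange K).torsionGaloisModule ((p ^ k : ℕ) : ℤ)) 1) ∈
        signPart W K τ ((p ^ k : ℕ) : ℤ) (if !eb s.1 then 1 else -1)
          (((selmerF0 W ((p ^ k : ℕ) : ℤ) 𝒯 𝒮 (placesDividing K s.1) Qcar).relaxedAt {v}).selmerGroup) := by
  have hp : p.Prime := Fact.out
  intro s s' ℓ hℓ hℓs hs' hlt hcs v hv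
  have hmem := hsel0 s s' ℓ hℓ hℓs hs' hlt hcs v hv
  -- the two standing inputs at level `p^k` for the datum at `s'`
  have hdiv : ∀ m : ℕ, m ∣ s'.1 → Squarefree m ∧ ∀ q ∈ m.primeFactors,
      Zhang2014.IsKolyvaginPrime (W.conductorNorm ℤ) W K p q ∧ k ≤ Zhang2014.kolyvaginIndex W p q :=
    fun m hm ↦ ⟨s'.2.1.squarefree_of_dvd hm, fun q hq ↦
      s'.2.2 q (Nat.primeFactors_mono hm s'.2.1.ne_zero hq)⟩
  have hKunr : ∀ v : HeightOneSpectrum (𝓞 ℚ), (p : 𝓞 ℚ) ∈ v.asIdeal →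
      Algebra.IsUnramifiedIn (𝓞 K) v.asIdeal :=
    isUnramifiedIn_of_satisfiesHeegnerHypothesis_of_dvd hK hHp hp (dvd_refl p)
  have hpn : ¬ p ∣ s'.1 := fun h ↦
    (s'.2.2 p (Nat.mem_primeFactors.mpr ⟨hp, h, s'.2.1.ne_zero⟩)).1.2.2.2.1 rfl
  have hA := NoTorsionIrr.isAdmissible_pointsSubgroup_of_hasIrreducibleModPGaloisRep (D s') hK s'.2.1.ne_zero
    hp hp2 hirr (W.exists_weilPairing_holds p) hKunr hpn k
  have hP := KolyCert.toGeomPoints_derivedPoint_mem_invPoints_of_dvd_zhang hK ι Dt hp hND hD s'.2.1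
    s'.2.2 (fun m hm ↦ D ⟨m, hdiv m hm⟩) s'.1 dvd_rfl
  -- Gross Prop. 5.4 (1) for `P_{s'}` itself (`u = 0`)
  have hkol : ∀ q ∈ s'.1.primeFactors,
      Zhang2014.IsKolyvaginPrime (W.conductorNorm ℤ) W K p q ∧ k + 0 ≤ Zhang2014.kolyvaginIndex W p q :=
    fun q hq ↦ ⟨(s'.2.2 q hq).1, by rw [Nat.add_zero]; exact (s'.2.2 q hq).2⟩
  have key := conjAct_kolyvaginClass_root_eq_sign_smul_zhang_of_irreducible (Dt := Dt) (β := β) hK hp hp2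
    hirr hHp hND hD hk s'.2.1 hkol (fun m hm ↦ D ⟨m, hdiv m hm⟩) hτ ε
    (fun m hm τm hτm ↦ h53 s' ⟨m, hdiv m hm⟩ hm τm hτm) (D s').derivedPoint (by simp) hA hP
  -- the sign `−ε(s) = ε(s')`
  have hs0 : s.1 ≠ 0 := s.2.1.ne_zero
  have hcard : s'.1.primeFactors.card = s.1.primeFactors.card + 1 := by
    rw [hs', Nat.primeFactors_mul hs0 hℓ.ne_zero, hℓ.primeFactors, Finset.union_comm,
      ← Finset.insert_eq, Finset.card_insert_of_notMem]
    exact fun h ↦ hℓs (Nat.dvd_of_mem_primeFactors h)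
  have hsign : (if !eb s.1 then (1 : ℤ) else -1) = ε * (-1) ^ s'.1.primeFactors.card := by
    rw [hcard, pow_succ, ← mul_assoc, ← hebε s.1]
    cases eb s.1 <;> simp
  rw [KolyvaginHeegnerData.kolyvaginClass_of_admissible (D s') hp k hA hP] at hmem ⊢
  exact (mem_signPart_iff W K τ _ _ _ _).mpr ⟨hmem, by rw [hsign]; exact key⟩

end Summit.BirchSwinnertonDyer.Rank1Residual.X11b.Three.Koly

end
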